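import Summits.ABC.IUTFork.Joshi.UntiltGaussNonIso
import Summits.ABC.IUTFork.Joshi.RosettaFragment1ATS1Bridge
import HarnessLib

/-!
# Consequences of the Gauss untilt: [J-III] Thm. 8.3.3.1's plurality AS TYPED, and the INDEPENDENCE of Joshi's two claim-`Prop`s `ActionChangesTopology` / `ActionDilates` on E-t1's signature

Proof-only sequel (abc-iut cell, branch E, rung LADDER-ABC:A2.E; seat abc-iut-E-t55 g3) of `Joshi/UntiltGaussNonIso.lean` (p447732:
`Untilt.gaussIrr`, `GaussUntilt.twoPoint`, `twoPoint_actionChangesTopology`, `twoPoint_not_actionDilates`) and E-t17's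
`Joshi/UntiltRescaled.lean` (`threePoint`, `threePoint_actionDilates`, `threePoint_topIso`), over E-t1's `UntiltPoints`
(`ExistsNonIsomorphic`, `ActionChangesTopology`, `ActionDilates`) and E-t16's `Rosetta.ManyInequivalentPictures` ([J-III] Thm.
8.3.3.1, p429272) with E-t16's bridge `manyInequivalentPictures_of_existsNonIsomorphic` (p432443). BY NAME; nothing restated.

WHAT IS PROVED (all AS TYPED — the signature `UntiltPoints` records no tilt; the Gauss untilt is not an untilt of `ℂ_p^♭`;
see the caveats of p447273/p447732; no side taken):
* `Rosetta.manyInequivalentPictures_twoPoint` — [J-III] Thm. 8.3.3.1's plurality clause («many inequivalent pictures»), typed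
  by E-t16 as `∃ i j, ¬ (K i).TopIso (K j)` and until now DISCHARGED MODULO E-t1's [KedlayaTemkin2018]-`Prop`, holds
  hypothesis-free on the family of residue fields of the two-point signature; `exists_pair_no_isometry_twoPoint` likewise.
* **Independence of Joshi's two [J-I] claim-`Prop`s on E-t1's signature**: `not_forall_actionChangesTopology_imp_actionDilates`
  (the two-point signature changes topology WITHOUT dilating valuations on `Q̄_p`) and
  `not_forall_actionDilates_imp_actionChangesTopology` (E-t17's three-point signature dilates WITHOUT changing topology).
  Hence the E1-side located sentences that take `ActionDilates` as premise (E-t1's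
  `DictionaryUntiltsVolume.not_movesAreInd_and_datumEquivariant`, `DictionaryUntiltsReadout.not_…_of_readout`) and those
  phrased with `ActionChangesTopology` / `ExistsNonIsomorphic` quantify over LOGICALLY INDEPENDENT typed predicates — which
  of the two Joshi's `Aut_{𝒪_E}(𝒢(𝒪_F))`-action satisfies is [J-I] Thm. 5.4.1 / Cor. 5.4.2 (dilatation, v4 §5) resp. §3.7 +
  [KedlayaTemkin2018] (topology), both claims, neither typed as a fact. Located, not adjudicated.
Typed ≠ proved ≠ endorsed; no side taken on [IUTchIII] Cor. 3.12 or on any author. bears_on: LADDER-ABC:A2.E.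
-/

noncomputable section

namespace Summit.ABC.IUTFork.Joshi

variable (p : ℕ) [Fact p.Prime]

/-- **[J-III] Thm. 8.3.3.1 plurality AS TYPED, hypothesis-free** on the two-point family `y ↦ K_y` (`ℂ_p`, `𝔾`, `𝔾`):
E-t16's `Rosetta.ManyInequivalentPictures`. [claim: Joshi2024ATS3, status: disputed] -/
theorem Rosetta.manyInequivalentPictures_twoPoint :
    Rosetta.ManyInequivalentPictures (GaussUntilt.twoPoint p).untilt :=
  Rosetta.manyInequivalentPictures_of_existsNonIsomorphic _ (GaussUntilt.twoPoint_existsNonIsomorphic p)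

/-- On the two-point family some two residue fields admit NO isometric field isomorphism (E-t16's
`exists_pair_no_isometry_of_existsNonIsomorphic`, now hypothesis-free). [folklore] -/
theorem Rosetta.exists_pair_no_isometry_twoPoint :
    ∃ y y' : (GaussUntilt.twoPoint p).Pt,
      ∀ e : ((GaussUntilt.twoPoint p).untilt y).K ≃+* ((GaussUntilt.twoPoint p).untilt y').K, ∃ x, ‖e x‖ ≠ ‖x‖ :=
  Rosetta.exists_pair_no_isometry_of_existsNonIsomorphic _ (GaussUntilt.twoPoint_existsNonIsomorphic p)

/-- **`ActionChangesTopology ⇏ ActionDilates` on E-t1's signature** (witness: the two-point signature, p447732). [folklore] -/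
theorem UntiltPoints.not_forall_actionChangesTopology_imp_actionDilates :
    ¬ ∀ D : UntiltPoints p (ZMod 2), D.ActionChangesTopology → D.ActionDilates :=
  fun h => GaussUntilt.twoPoint_not_actionDilates p (h _ (GaussUntilt.twoPoint_actionChangesTopology p))

/-- **`ActionDilates ⇏ ActionChangesTopology` on E-t1's signature** (witness: E-t17's three-point signature of rescaled
`ℂ_p`'s with profile exponent `c = 2`: it dilates, `threePoint_actionDilates`, while all its residue fields are topologically
isomorphic, `threePoint_topIso`). [folklore] -/
theorem UntiltPoints.not_forall_actionDilates_imp_actionChangesTopology :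
    ¬ ∀ D : UntiltPoints p (ZMod 2), D.ActionDilates → D.ActionChangesTopology := by
  intro h
  obtain ⟨σ, y, hne⟩ := h _ (threePoint_actionDilates p 2 two_pos (by norm_num))
  exact hne (threePoint_topIso p 2 two_pos _ _)

/-- **`ActionDilates ⇏ ExistsNonIsomorphic`** likewise (same witness). [folklore] -/
theorem UntiltPoints.not_forall_actionDilates_imp_existsNonIsomorphic :
    ¬ ∀ D : UntiltPoints p (ZMod 2), D.ActionDilates → D.ExistsNonIsomorphic := by
  intro h
  obtain ⟨y, y', hne⟩ := h _ (threePoint_actionDilates p 2 two_pos (by norm_num))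
  exact hne (threePoint_topIso p 2 two_pos _ _)

/-- **`ExistsNonIsomorphic ⇏ ActionDilates`** likewise (witness: the two-point signature). [folklore] -/
theorem UntiltPoints.not_forall_existsNonIsomorphic_imp_actionDilates :
    ¬ ∀ D : UntiltPoints p (ZMod 2), D.ExistsNonIsomorphic → D.ActionDilates :=
  fun h => GaussUntilt.twoPoint_not_actionDilates p (h _ (GaussUntilt.twoPoint_existsNonIsomorphic p))

/-- Summary: BOTH claim-`Prop`s are satisfiable on E-t1's signature, SEPARATELY — `ActionChangesTopology ∧ ¬ ActionDilates`
(two-point) and `ActionDilates ∧ ¬ ActionChangesTopology` (three-point, `c = 2`). [folklore] -/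
theorem UntiltPoints.claims_independent :
    (∃ D : UntiltPoints p (ZMod 2), D.ActionChangesTopology ∧ ¬ D.ActionDilates) ∧
      (∃ D : UntiltPoints p (ZMod 2), D.ActionDilates ∧ ¬ D.ActionChangesTopology) := by
  refine ⟨⟨GaussUntilt.twoPoint p, GaussUntilt.twoPoint_changesTopology_not_dilates p⟩,
    ⟨threePoint p 2 two_pos, threePoint_actionDilates p 2 two_pos (by norm_num), ?_⟩⟩
  rintro ⟨σ, y, hne⟩
  exact hne (threePoint_topIso p 2 two_pos _ _)

end Summit.ABC.IUTFork.Joshi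


/-! ## NOTE (erratum to the docstrings, append-only; abc-iut-E-t55 g3)

ATTRIBUTION CORRECTION. «E-t17's `Joshi/UntiltRescaled.lean` (`threePoint`, `threePoint_actionDilates`, `threePoint_topIso`)» in
the header and «E-t17's three-point signature» in the docstrings of `not_forall_actionDilates_imp_actionChangesTopology` and
`claims_independent` should read «abc-iut-**E-t1**'s … (`Joshi/UntiltRescaled.lean`, **p432361**)». No declaration is touched. -/

end
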